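import Summits.BirchSwinnertonDyer.Rank1Residual.Additive.StrictSignedSelmerPreimageZeroPadic
import Summits.BirchSwinnertonDyer.Rank1Residual.Additive.SubSelmerControlZeroExact
import HarnessLib

/-!
# Exact bottom-layer control with the defect EXPRESSED BY LOCAL CONDITIONS:
# `ord_p #Sel^{ε,str}(E/K) + ord_p #(Sel^{loc,∞}(E/K) ⧸ Sel^{ε,str}(E/K)) = ord_p f(0)`, where
# `Sel^{loc,∞}(E/K)` is the Selmer group over `K` of the pulled-back LEVEL-`∞` conditions — bricks
# B1 ⊕ B2 of the GLOBAL count (C) assembled (cell `b2b-bsdres`, CLASS-CLOSURE lane, class O10 —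
# x1b GEN 35, class lead; file 49 of the series)

HONEST FRAMING (cell `b2b-bsdres`, run/shared/lean/b2b/bsd-rank1-residual/, verbatim in every
file): the goal of the cell is to DELETE the COMBINATION-SHAPED residual classes of the
Birch–Swinnerton-Dyer formula for ALL analytic-rank `≤ 1` elliptic curves over `ℚ` — "full BSD
formula for every rank `≤ 1` curve in class `C`" assembled STRICTLY from published theorems — so
that the rank-`≤ 1` remainder becomes exactly the CONSTRUCTION-SHAPED classes, which are TYPED
(missing-input `Prop`s), NOT attempted. This is not "finishing BSD". CLASS-CLOSURE lane: prove
what is provable now; shrink each hard class to its core with data; no claim beyond stated classes;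
research routes on CONSTRUCTION-SHAPED X12 / O10; census / instrument output = EVIDENCE / conjecture
items, NEVER a Literature fact; `RESIDUAL-MAP.md` marks change only by signed lines. THIS FILE:
TOOL THEOREMS ONLY (gen 34's B1 `StrictSignedControlZero.finite_and_padicValNat_card_add_eq` read
through this gen's B2 `comap_layerToInfty_zero_strictSignedSelmerInfty_eq`) — no definition, no named
Literature fact, no Summits-side fact `def … : Prop`, no `sorry`, axioms standard; nothing is booked;
no label / mark / count / sub-cell moves; (C1_η), (C2_η-GZ), (C3_η) stay typed as filed; O10 stays
OPEN / CONSTRUCTION-SHAPED; nothing about `BSD(W, p)` of any pair is claimed.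

## What (bricks B1 + B2 of `HSUM-UNCONDITIONAL-x1b.md` §3b)

B1 (gen 34, file 42): `ord_p #S₀ + ord_p #(A₀ ⧸ S₀) = ord_p f(0)` with `A₀ = h₀⁻¹(Sel^{ε,str}(E/K_∞))`.
B2 (this gen, files 44–48): `A₀ = Sel^{loc,∞}(E/K) := h₀⁻¹(Sel_{p^∞}(E/K_∞) ⊓ ⨅_σ conj_σ⁻¹ Kummer_∞(⋃ₙ
E^{ε,str}(K_n·E)))`, the classes over `K` whose restriction to `K_∞` satisfies the LEVEL-`∞` local
conditions (classical everywhere; strict signed at `E`). Hence Greenberg's shape of the control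
theorem at the bottom layer, with the defect `ker g₀` written as a quotient of a group DEFINED BY
LOCAL CONDITIONS:

* `finite_and_padicValNat_card_localPreimage_add_eq` (any `K`, `κ`, model `E`, sign `ε`; hypotheses
  (hS) `S ⊇ {v ∣ p} ∪ {bad v}` finite, (htors) `E(K_∞·E)[p^∞] = 0`, (hB) `E(K_∞)[p^∞] = 0`, and the
  dual datum `D` with `X` f.g. torsion, no finite submodule, `char = (f)`, `f(0) ≠ 0`):
  **`ord_p #Sel^{ε,str}(E/K) + ord_p #(Sel^{loc,∞}(E/K) ⧸ Sel^{ε,str}(E/K)) = ord_p f(0)`**, both groups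
  finite;
* `finite_and_padicValNat_card_localPreimage_add_eq_padic` / `_of_goodSupersingular`: the same at
  `E = ℚ_p` for a good supersingular `ℤ_p`-model (`p ≥ 3`), resp. for `W ⊗ ℚ̄_p = V ⊗ ℚ̄_p` with
  `V/ℚ` globally minimal, good at `p`, `a_p(V) = 0` — with (hS), (htors) AND (hB) DISCHARGED
  (`exists_finset_forall_not_mem_good`; gen 32's Prop. 8.7 locally and globally with `K₀ = K`):
  the only remaining inputs are the dual datum and its `Λ`-module properties ((C1_η)-side data:
  Kobayashi Thm. 2.2 / 7.4, Kitajima–Otsuki), exactly as in B1.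

The quotient `Sel^{loc,∞}(E/K) ⧸ Sel^{ε,str}(E/K)` embeds into the product of the level-`0` local
receptacles at `S ∪ {E}` (file 47 §2); its COUNT (`= p^ν · ∏_{ℓ≠p} c_ℓ^{(p)}` for the twist of the
(C3_η) derivation) is bricks B3–B7.

References: [GreenbergLNM1716] R. Greenberg, LNM 1716 (1999), §3 pp. 85–90, §4 Thm. 4.1 and Lemma
4.2 (p. 102); [Kobayashi2003] S. Kobayashi, Invent. Math. 152 (2003), Def. 2.1 (p. 5), Prop. 8.7
(p. 16), Lemma 9.1 (p. 25), Thm. 9.3 (p. 26).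
-/

noncomputable section

open scoped Classical

open NumberField IsDedekindDomain WeierstrassCurve Literature.NumberTheory.EllipticCurves
  Literature.NumberTheory.GaloisRepresentations Literature.NumberTheory.EllipticCurves.IwasawaAlgebra
  Literature.NumberTheory.EllipticCurves.IwasawaDual Literature.NumberTheory.EllipticCurves.Kobayashi2003
  ZpExtension

universe u

namespace Summit.BirchSwinnertonDyer.Rank1Residual.Additive

namespace StrictSignedControlZero

/-! ## §1 B1 ⊕ B2: the defect as a quotient of the local-conditions group -/

section General

variable {K : Type u} [Field K] [NumberField K] (W : WeierstrassCurve K) {p : ℕ} [Fact p.Prime]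
  (κ : ZpExtension K p) (E : Type u) [Field E] [Algebra K E] (ε : ℤˣ)

/-- **`ord_p #Sel^{ε,str}(E/K) + ord_p #(Sel^{loc,∞}(E/K) ⧸ Sel^{ε,str}(E/K)) = ord_p f(0)`.** Gen 34's
exact bottom-layer identity (B1, `finite_and_padicValNat_card_add_eq`) with the preimage
`A₀ = h₀⁻¹(Sel^{ε,str}(E/K_∞))` replaced by the group `Sel^{loc,∞}(E/K)` of classes over `K` whose
restriction to `K_∞` lies in `Sel_{p^∞}(E/K_∞)` and in the strict signed Kummer condition cut out by
`⋃ₙ E^{ε,str}(K_n·E)` at every conjugate of the chosen embedding (B2,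
`comap_layerToInfty_zero_strictSignedSelmerInfty_eq`). Hypotheses: `W` elliptic; (hS); (htors);
(hB) `E(K_∞)[p^∞] = 0`; the dual datum `D` of `Sel^{ε,str}(E/K_∞)` with `X` f.g. torsion, no
non-trivial finite `Λ`-submodule, `char(X) = (f)`, `f(0) ≠ 0`.
[cite: GreenbergLNM1716, §3 pp. 85–90 and §4 Lemma 4.2 (p. 102)] [cite: Kobayashi2003, Lemma 9.1 (p. 25), Thm. 9.3 (p. 26)] -/
theorem finite_and_padicValNat_card_localPreimage_add_eq [W.IsElliptic]
    {γ : Field.absoluteGaloisGroup K} (hγ : κ.IsTopGenerator γ) (D : StrictSignedSelmerDualData W κ E γ ε)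
    [Module.Finite (IwasawaAlgebra p) D.X] (hX : Module.IsTorsion (IwasawaAlgebra p) D.X)
    (hB : FixedPoints.addSubgroup κ.kerSubgroup (W.geomPrimaryTorsion p) = ⊥)
    (hnf : ∀ N : Submodule (IwasawaAlgebra p) D.X, Finite N → N = ⊥)
    {f : IwasawaAlgebra p} (hf : D.charIdeal = Ideal.span {f})
    (h0 : PowerSeries.constantCoeff f ≠ 0)
    (S : Finset (HeightOneSpectrum (𝓞 K)))
    (hS : ∀ v ∉ S, (p : 𝓞 K) ∉ v.asIdeal ∧ W.HasGoodReductionAt v)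
    (htors : ∀ P : localPoints W E, P ∈ localFixedPointsOfEmb (closureEmb (K := K) E) W κ.kerSubgroup →
      (∃ j : ℕ, p ^ j • P = 0) → P = 0) :
    Finite (strictSignedSelmerLayer W κ E ε 0) ∧
      Finite (↥((W.selmerInfty κ ⊓
          ⨅ σ : Field.absoluteGaloisGroup K,
            (localKummerOverOfEmb W p κ.kerSubgroup (closureEmb (K := K) E)
                (⨆ m, strictSignedLocalPoints κ E W ε m)).comap (W.conjH1 p κ.kerSubgroup σ)).comap
          (W.layerToInfty κ 0)) ⧸
        (strictSignedSelmerLayer W κ E ε 0).addSubgroupOf ((W.selmerInfty κ ⊓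
          ⨅ σ : Field.absoluteGaloisGroup K,
            (localKummerOverOfEmb W p κ.kerSubgroup (closureEmb (K := K) E)
                (⨆ m, strictSignedLocalPoints κ E W ε m)).comap (W.conjH1 p κ.kerSubgroup σ)).comap
          (W.layerToInfty κ 0))) ∧
      (padicValNat p (Nat.card (strictSignedSelmerLayer W κ E ε 0)) : ℤ) +
          padicValNat p (Nat.card (↥((W.selmerInfty κ ⊓
            ⨅ σ : Field.absoluteGaloisGroup K,
              (localKummerOverOfEmb W p κ.kerSubgroup (closureEmb (K := K) E)
                  (⨆ m, strictSignedLocalPoints κ E W ε m)).comap (W.conjH1 p κ.kerSubgroup σ)).comap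
            (W.layerToInfty κ 0)) ⧸
          (strictSignedSelmerLayer W κ E ε 0).addSubgroupOf ((W.selmerInfty κ ⊓
            ⨅ σ : Field.absoluteGaloisGroup K,
              (localKummerOverOfEmb W p κ.kerSubgroup (closureEmb (K := K) E)
                  (⨆ m, strictSignedLocalPoints κ E W ε m)).comap (W.conjH1 p κ.kerSubgroup σ)).comap
            (W.layerToInfty κ 0)))) =
        ((PowerSeries.constantCoeff f : ℤ_[p]) : ℚ_[p]).valuation := by
  rw [← comap_layerToInfty_zero_strictSignedSelmerInfty_eq W κ E ε S hS htors]
  exact finite_and_padicValNat_card_add_eq W κ E ε hγ D hX hB hnf hf h0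

end General

/-! ## §2 At `E = ℚ_p` for good supersingular reduction: (hS), (htors), (hB) discharged -/

section Padic

variable {p : ℕ} [hp : Fact p.Prime] {K : Type} [Field K] [NumberField K] [Algebra K ℚ_[p]]
  (κ : ZpExtension K p) (W : WeierstrassCurve K) [W.IsElliptic] (ε : ℤˣ)

/-- **(hB) at `E = ℚ_p`: `E(K_∞)[p^∞] = 0` for a good supersingular `ℤ_p`-model, `p ≥ 3`** — gen 32's
`fixedPoints_towerTopSubgroup_geomPrimaryTorsion_eq_bot_padic` with `K₀ = K`
(`towerTopSubgroup κ K ≤ ker κ`: a point fixed by `Gal(K̄/K_∞)` is fixed by the smaller group).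
[cite: Kobayashi2003, Prop. 8.7 (p. 16), Lemma 9.1 (p. 25)] -/
theorem fixedPoints_kerSubgroup_geomPrimaryTorsion_eq_bot_padic (hp2 : p ≠ 2)
    (M : WeierstrassCurve ℤ_[p]) (hΔ : IsUnit M.Δ)
    (hA : M.hasseCoeff p ∈ IsLocalRing.maximalIdeal ℤ_[p])
    (hWM : M.baseChange (AlgebraicClosure ℚ_[p]) = W.baseChange (AlgebraicClosure ℚ_[p])) :
    FixedPoints.addSubgroup κ.kerSubgroup (W.geomPrimaryTorsion p) = ⊥ := by
  haveI : (galRange (K := K) K).Normal := RelModel.normal_galRange (K := K) K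
  have hlt : Module.finrank K K < (p ^ 2 - 1) / 2 := by
    rw [Module.finrank_self]
    have hp3 : 3 ≤ p := by
      rcases Nat.lt_or_ge p 3 with h | h
      · exfalso
        interval_cases p
        · exact hp.out.ne_zero rfl
        · exact hp.out.ne_one rfl
        · exact hp2 rfl
      · exact h
    have h9 : 9 ≤ p ^ 2 := by nlinarith
    omega
  obtain ⟨hK0, hK⟩ := index_galRange_ne_zero_and_lt (p := p) (K := K) K hlt
  have htop := fixedPoints_towerTopSubgroup_geomPrimaryTorsion_eq_bot_padic κ K
    (closureEmb (K := K) ℚ_[p]) W hp2 M hΔ hA hWM hK0 hK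
  rw [eq_bot_iff] at htop ⊢
  intro m hm
  refine htop ?_
  rw [FixedPoints.mem_addSubgroup] at hm ⊢
  intro σ
  exact hm ⟨(σ : Field.absoluteGaloisGroup K), towerTopSubgroup_le_kerSubgroup κ K σ.2⟩

/-- **B1 ⊕ B2 at `E = ℚ_p`, model form**: for `W/K` (`K → ℚ_p`) with a good supersingular
`ℤ_p`-model at the embedding, `p ≥ 3`, any `ℤ_p`-extension `κ` with topological generator `γ`, any
sign `ε`, and a dual datum `D` of `Sel^{ε,str}(E/K_∞)` (model `ℚ_p`) with `X` f.g. torsion, no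
finite submodule, `char = (f)`, `f(0) ≠ 0`:
**`ord_p #Sel^{ε,str}(E/K) + ord_p #(Sel^{loc,∞}(E/K) ⧸ Sel^{ε,str}(E/K)) = ord_p f(0)`**, with NO
further hypothesis ((hS), (htors), (hB) discharged). [cite: GreenbergLNM1716, §3 pp. 85–90 and §4 Lemma 4.2 (p. 102)]
[cite: Kobayashi2003, Prop. 8.7 (p. 16), Lemma 9.1 (p. 25), Thm. 9.3 (p. 26)] -/
theorem finite_and_padicValNat_card_localPreimage_add_eq_padic (hp2 : p ≠ 2)
    (M : WeierstrassCurve ℤ_[p]) (hΔ : IsUnit M.Δ)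
    (hA : M.hasseCoeff p ∈ IsLocalRing.maximalIdeal ℤ_[p])
    (hWM : M.baseChange (AlgebraicClosure ℚ_[p]) = W.baseChange (AlgebraicClosure ℚ_[p]))
    {γ : Field.absoluteGaloisGroup K} (hγ : κ.IsTopGenerator γ)
    (D : StrictSignedSelmerDualData W κ ℚ_[p] γ ε)
    [Module.Finite (IwasawaAlgebra p) D.X] (hX : Module.IsTorsion (IwasawaAlgebra p) D.X)
    (hnf : ∀ N : Submodule (IwasawaAlgebra p) D.X, Finite N → N = ⊥)
    {f : IwasawaAlgebra p} (hf : D.charIdeal = Ideal.span {f})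
    (h0 : PowerSeries.constantCoeff f ≠ 0) :
    Finite (strictSignedSelmerLayer W κ ℚ_[p] ε 0) ∧
      Finite (↥((W.selmerInfty κ ⊓
          ⨅ σ : Field.absoluteGaloisGroup K,
            (localKummerOverOfEmb W p κ.kerSubgroup (closureEmb (K := K) ℚ_[p])
                (⨆ m, strictSignedLocalPoints κ ℚ_[p] W ε m)).comap (W.conjH1 p κ.kerSubgroup σ)).comap
          (W.layerToInfty κ 0)) ⧸
        (strictSignedSelmerLayer W κ ℚ_[p] ε 0).addSubgroupOf ((W.selmerInfty κ ⊓
          ⨅ σ : Field.absoluteGaloisGroup K,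
            (localKummerOverOfEmb W p κ.kerSubgroup (closureEmb (K := K) ℚ_[p])
                (⨆ m, strictSignedLocalPoints κ ℚ_[p] W ε m)).comap (W.conjH1 p κ.kerSubgroup σ)).comap
          (W.layerToInfty κ 0))) ∧
      (padicValNat p (Nat.card (strictSignedSelmerLayer W κ ℚ_[p] ε 0)) : ℤ) +
          padicValNat p (Nat.card (↥((W.selmerInfty κ ⊓
            ⨅ σ : Field.absoluteGaloisGroup K,
              (localKummerOverOfEmb W p κ.kerSubgroup (closureEmb (K := K) ℚ_[p])
                  (⨆ m, strictSignedLocalPoints κ ℚ_[p] W ε m)).comap (W.conjH1 p κ.kerSubgroup σ)).comap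
            (W.layerToInfty κ 0)) ⧸
          (strictSignedSelmerLayer W κ ℚ_[p] ε 0).addSubgroupOf ((W.selmerInfty κ ⊓
            ⨅ σ : Field.absoluteGaloisGroup K,
              (localKummerOverOfEmb W p κ.kerSubgroup (closureEmb (K := K) ℚ_[p])
                  (⨆ m, strictSignedLocalPoints κ ℚ_[p] W ε m)).comap (W.conjH1 p κ.kerSubgroup σ)).comap
            (W.layerToInfty κ 0)))) =
        ((PowerSeries.constantCoeff f : ℤ_[p]) : ℚ_[p]).valuation := by
  obtain ⟨S, hS⟩ := exists_finset_forall_not_mem_good W p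
  exact finite_and_padicValNat_card_localPreimage_add_eq W κ ℚ_[p] ε hγ D hX
    (fixedPoints_kerSubgroup_geomPrimaryTorsion_eq_bot_padic κ W hp2 M hΔ hA hWM) hnf hf h0 S hS
    (eq_zero_of_prime_pow_smul_eq_zero_localFixedPointsOfEmb_kerSubgroup_padic κ (closureEmb (K := K) ℚ_[p])
      W hp2 M hΔ hA hWM)

/-- **B1 ⊕ B2 at `E = ℚ_p` for a globally minimal good supersingular `V/ℚ` read over `K`**
(`W ⊗ ℚ̄_p = V ⊗ ℚ̄_p`, `V.HasGoodReductionAtPrime p`, `a_p(V) = 0`, `p ≥ 3`); for `K = ℚ`, `W = V`,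
`κ` cyclotomic, `ε = ±1` this is the bottom layer of the control of Kobayashi's `Sel^±(E/ℚ_∞)` with
the defect written by local conditions. [cite: Kobayashi2003, Prop. 8.7 (p. 16), Lemma 9.1 (p. 25), Thm. 9.3 (p. 26)]
[cite: GreenbergLNM1716, §3 pp. 85–90 and §4 Lemma 4.2 (p. 102)] -/
theorem finite_and_padicValNat_card_localPreimage_add_eq_of_goodSupersingular (hp2 : p ≠ 2)
    (V : WeierstrassCurve ℚ) [V.IsElliptic] [V.IsGloballyMinimal]
    (hgood : V.HasGoodReductionAtPrime p) (hap : V.frobeniusTrace p = 0)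
    (hWV : W.baseChange (AlgebraicClosure ℚ_[p]) = V.baseChange (AlgebraicClosure ℚ_[p]))
    {γ : Field.absoluteGaloisGroup K} (hγ : κ.IsTopGenerator γ)
    (D : StrictSignedSelmerDualData W κ ℚ_[p] γ ε)
    [Module.Finite (IwasawaAlgebra p) D.X] (hX : Module.IsTorsion (IwasawaAlgebra p) D.X)
    (hnf : ∀ N : Submodule (IwasawaAlgebra p) D.X, Finite N → N = ⊥)
    {f : IwasawaAlgebra p} (hf : D.charIdeal = Ideal.span {f})
    (h0 : PowerSeries.constantCoeff f ≠ 0) :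
    Finite (strictSignedSelmerLayer W κ ℚ_[p] ε 0) ∧
      Finite (↥((W.selmerInfty κ ⊓
          ⨅ σ : Field.absoluteGaloisGroup K,
            (localKummerOverOfEmb W p κ.kerSubgroup (closureEmb (K := K) ℚ_[p])
                (⨆ m, strictSignedLocalPoints κ ℚ_[p] W ε m)).comap (W.conjH1 p κ.kerSubgroup σ)).comap
          (W.layerToInfty κ 0)) ⧸
        (strictSignedSelmerLayer W κ ℚ_[p] ε 0).addSubgroupOf ((W.selmerInfty κ ⊓
          ⨅ σ : Field.absoluteGaloisGroup K,
            (localKummerOverOfEmb W p κ.kerSubgroup (closureEmb (K := K) ℚ_[p])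
                (⨆ m, strictSignedLocalPoints κ ℚ_[p] W ε m)).comap (W.conjH1 p κ.kerSubgroup σ)).comap
          (W.layerToInfty κ 0))) ∧
      (padicValNat p (Nat.card (strictSignedSelmerLayer W κ ℚ_[p] ε 0)) : ℤ) +
          padicValNat p (Nat.card (↥((W.selmerInfty κ ⊓
            ⨅ σ : Field.absoluteGaloisGroup K,
              (localKummerOverOfEmb W p κ.kerSubgroup (closureEmb (K := K) ℚ_[p])
                  (⨆ m, strictSignedLocalPoints κ ℚ_[p] W ε m)).comap (W.conjH1 p κ.kerSubgroup σ)).comap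
            (W.layerToInfty κ 0)) ⧸
          (strictSignedSelmerLayer W κ ℚ_[p] ε 0).addSubgroupOf ((W.selmerInfty κ ⊓
            ⨅ σ : Field.absoluteGaloisGroup K,
              (localKummerOverOfEmb W p κ.kerSubgroup (closureEmb (K := K) ℚ_[p])
                  (⨆ m, strictSignedLocalPoints κ ℚ_[p] W ε m)).comap (W.conjH1 p κ.kerSubgroup σ)).comap
            (W.layerToInfty κ 0)))) =
        ((PowerSeries.constantCoeff f : ℤ_[p]) : ℚ_[p]).valuation := by
  obtain ⟨M, hΔ, hA, hVM⟩ := exists_goodSupersingularPadicModel hp2 V hgood hap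
  exact finite_and_padicValNat_card_localPreimage_add_eq_padic κ W ε hp2 M hΔ hA (hVM.trans hWV.symm)
    hγ D hX hnf hf h0

end Padic

end StrictSignedControlZero

end Summit.BirchSwinnertonDyer.Rank1Residual.Additive

end
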